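import Summits.QuantumAdvantage.AdviceFreeQNC0.ExpBridge
import Summits.QuantumAdvantage.AdviceFreeQNC0.SqrtDegreeHardness
import HarnessLib

/-!
# Cell qa-qnc0 — rung F-Q1-exp CLOSED in the kernel: `HLFNotFAC0ModExp 2`, unconditionally

Planner qa-qnc0-p2 g12, ROUND-12 §A (`Sketch12b.lean` §4, `ladder_two`): composing the landed pieces

* `longGridCycle : LongGridCycle` (`LongGridCycle.lean`, E3),
* `ringHardLinSqrt_two : RingHardLinSqrt 2` (`SqrtDegreeHardness.lean`, E1 + E2 from the tube bound
  `tubeMass`/`binomTailLower`/`tubeBound` of α's proof),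
* `expBridge 2 : LongGridCycle → RingHardLinSqrt 2 → HLFNotFAC0ModExp 2` (`ExpBridge.lean`, E4),

gives **`hlfNotFAC0ModExp_two : HLFNotFAC0ModExp 2`** — for one gap `θ < 1` and every depth `d` there are `c, N₀`
such that for all `N ≥ N₀` and all `M` with `c·(M + log₂ N)^{d+1} ≤ N`, every family of depth-`d` `AC⁰[2]` circuits
of size `≤ 2^M` with `r` uniformly random shared bits (no advice on either side) fails the `N × N` 2D Hidden Linear
Function problem on some valid instance with probability `≥ 1 − θ`: an EXPONENTIAL-size (`2^{Ω(N^{1/(d+1)})}`),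
advice-free separation of `QNC⁰` (BGK's constant-depth circuit solves 2D HLF with certainty, tree
`qnc0Solves_hlfFamily`) from `AC⁰[2]/rpoly` for a relation problem.  Also `hlfNotFAC0Mod_two_of_exp : HLFNotFAC0Mod 2`
(the polynomial-size statement of rung F-Q1's classical side, re-derived through the exponential rung).

WHAT THIS IS NOT: not the `GC⁰(k)[2]` statement (F-Q1⁺, `GCBridge.lean` + qn-lit's ball-gate Razborov–Smolensky);
not Grewal–Kumar's sharp additive regime; the route-level bookkeeping (rung leaf, `closes`) is the ledger's;
separation recorded on the ledger only when the coordinator's leaf/route items are closed by name.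
-/

namespace Summit.QuantumAdvantage.AdviceFreeQNC0

/-- **Rung F-Q1-exp: `HLFNotFAC0ModExp 2` — PROVED UNCONDITIONALLY** (2D HLF defeats exponential-size
`AC⁰[2]/rpoly`, uniform random bits, no quantum advice). -/
theorem hlfNotFAC0ModExp_two : HLFNotFAC0ModExp 2 := expBridge 2 longGridCycle ringHardLinSqrt_two

/-- The polynomial-size statement `HLFNotFAC0Mod 2` (rung F-Q1's classical half) through the exponential rung. -/
theorem hlfNotFAC0Mod_two_of_exp : HLFNotFAC0Mod 2 := hlfNotFAC0Mod_of_exp 2 hlfNotFAC0ModExp_two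

/-- The exponential statement for every prime `p`, conditional only on ring hardness at `𝔽_p`-degree `⌊√n⌋`
(`RingHardLinSqrt p`; proved for `p = 2`, open for odd `p`). -/
theorem hlfNotFAC0ModExp_of_ringHardLinSqrt' (p : ℕ) [Fact p.Prime] (h : RingHardLinSqrt p) :
    HLFNotFAC0ModExp p :=
  expBridge p longGridCycle h

end Summit.QuantumAdvantage.AdviceFreeQNC0
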